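import Summits.QuantumFields.YangMills.Theorems.IR.LevelwiseDominationDefs
import HarnessLib

/-!
# Crux `IRcof` (stmt-QuantumFields-26930) — supplier line «lipschitz-vacuum-transport», part 2: LEMMA A — the free massive tower is
# uniformly small at the cold `4:1` aspect (real analysis, kernel-checked; proofs byte-identical to the certified bytes c2701ff81c6bc899 §2)

Helper module for `Summit.QuantumFields.YangMills.Theses.BalabanLadder.IRcof` (`--supports stmt-QuantumFields-26930`; closes nothing).
Content: elementary bounds on the lattice dispersion (`mass_le_latticeDispersion`, Jordan's inequality on the discrete torus
`torus_sin_lower`, the relativistic lower bound `latticeDispersion_lower`), the one-dimensional torus weight sum `torus_weight_sum_le`, and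
LEMMA A `gaussTowerExcess_small`: for `d` species and speed margin `c > 0`, for every `ε > 0` there is `A` such that every box `L ≥ 8` and
mass `m ≥ 0` with `m·⌊L/4⌋ ≥ A` has free-tower trace excess `gaussTowerExcess d m c L ⌊L/4⌋ ≤ ε` — uniformly in `L` (the lattice
momentum sum is controlled by a geometric series in the torus distance, not by the volume).  Used by `LevelwiseDominationKernel`.

HONEST FRAMING: supplier-line bookkeeping for a CONDITIONAL reduction of the junior binder `IRcof` (the infinite-volume rung R2c of a
conditional chain); `LevelwiseDominatedCofinal` is an OPEN, width-0 line statement (it contains the volume-uniform lattice mass gap); nothing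
here proves it, `PinnedExitsCofinalAt (1/24)`, `IRnscCof`, `IRcof`, `IR`, any leg, or the Yang–Mills mass gap (Clay) — NOT proved; NOT
continuum ∕ OS.  R4 closes only the conditional finite-𝕋⁴ rung `BalabanLadder.UV`.
-/

set_option autoImplicit false

noncomputable section

open Filter Topology MeasureTheory
open scoped BigOperators
open Literature.MathematicalPhysics.QuantumFieldTheory Literature.MathematicalPhysics.QuantumLattice
open Summit.QuantumFields.YangMills.Cruxes.OSLegsFromFemtoAndGap.DlrCollarTransfer (LowerBounds)
open Summit.QuantumFields.YangMills.Cruxes.IR.RankPurity (IsRatioDatum)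

namespace Summit.QuantumFields.YangMills.Cruxes.IR.LevelwiseDomination

/-! ## Lemma A and its elementary inputs -/

/-- `m ≤ ω(k)` for `m ≥ 0`. -/
theorem mass_le_latticeDispersion {m : ℝ} (hm : 0 ≤ m) (c : ℝ) (L : ℕ) (k : Fin 3 → Fin L) :
    m ≤ latticeDispersion m c L k := by
  unfold latticeDispersion
  calc m = Real.sqrt (m ^ 2) := (Real.sqrt_sq hm).symm
    _ ≤ Real.sqrt (m ^ 2 + c ^ 2 * ∑ j : Fin 3, (2 * Real.sin (Real.pi * ((k j : ℕ) : ℝ) / L)) ^ 2) := by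
        apply Real.sqrt_le_sqrt
        have : 0 ≤ c ^ 2 * ∑ j : Fin 3, (2 * Real.sin (Real.pi * ((k j : ℕ) : ℝ) / L)) ^ 2 := by positivity
        linarith

/-- A non-zero occupation has energy at least the mass. -/
theorem mass_le_occupationEnergy (d : ℕ) {m : ℝ} (hm : 0 ≤ m) (c : ℝ) (L : ℕ) {g : Fin d × (Fin 3 → Fin L) → ℕ}
    (hg : g ≠ 0) : m ≤ occupationEnergy d m c L g := by
  obtain ⟨p, hp⟩ : ∃ p, g p ≠ 0 := by
    exact Function.ne_iff.mp hg
  unfold occupationEnergy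
  have h1 : (1 : ℝ) ≤ (g p : ℝ) := by exact_mod_cast Nat.one_le_iff_ne_zero.mpr hp
  have hω : m ≤ latticeDispersion m c L p.2 := mass_le_latticeDispersion hm c L p.2
  calc m ≤ (g p : ℝ) * latticeDispersion m c L p.2 := by nlinarith
    _ ≤ ∑ q : Fin d × (Fin 3 → Fin L), (g q : ℝ) * latticeDispersion m c L q.2 := by
        apply Finset.single_le_sum (f := fun q => (g q : ℝ) * latticeDispersion m c L q.2) _ (Finset.mem_univ p)
        intro q _
        exact mul_nonneg (Nat.cast_nonneg _) (hm.trans (mass_le_latticeDispersion hm c L q.2))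

/-- Jordan's inequality on the discrete torus: `2·dist(n, Lℤ)/L ≤ sin(π n/L)` for `0 ≤ n < L`. -/
theorem torus_sin_lower (L n : ℕ) (hL : 0 < L) (hn : n < L) :
    2 * ((min n (L - n) : ℕ) : ℝ) / L ≤ Real.sin (Real.pi * (n : ℝ) / L) := by
  have hLr : (0 : ℝ) < L := by exact_mod_cast hL
  have hpi := Real.pi_pos
  rcases le_or_gt n (L - n) with h | h
  · rw [min_eq_left h]
    have h2 : 2 * (n : ℝ) ≤ L := by
      have : 2 * n ≤ L := by omega
      exact_mod_cast this
    have hx0 : 0 ≤ Real.pi * (n : ℝ) / L := by positivity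
    have hx1 : Real.pi * (n : ℝ) / L ≤ Real.pi / 2 := by
      rw [div_le_div_iff₀ hLr (by norm_num : (0:ℝ) < 2)]
      nlinarith
    have e : 2 / Real.pi * (Real.pi * (n : ℝ) / L) = 2 * (n : ℝ) / L := by
      field_simp
    rw [← e]
    exact Real.mul_le_sin hx0 hx1
  · rw [min_eq_right h.le]
    have hcast : ((L - n : ℕ) : ℝ) = (L : ℝ) - n := Nat.cast_sub hn.le
    have hnL : (n : ℝ) ≤ L := by exact_mod_cast hn.le
    have h2 : 2 * ((L : ℝ) - n) ≤ L := by
      have h' : 2 * (L - n) ≤ L := by omega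
      have h'' : ((2 * (L - n) : ℕ) : ℝ) ≤ L := by exact_mod_cast h'
      push_cast [Nat.cast_sub hn.le] at h''
      linarith
    have hx0 : 0 ≤ Real.pi * ((L : ℝ) - n) / L :=
      div_nonneg (mul_nonneg hpi.le (by linarith)) hLr.le
    have hx1 : Real.pi * ((L : ℝ) - n) / L ≤ Real.pi / 2 := by
      rw [div_le_div_iff₀ hLr (by norm_num : (0:ℝ) < 2)]
      nlinarith
    have hsin : Real.sin (Real.pi * (n : ℝ) / L) = Real.sin (Real.pi * ((L : ℝ) - n) / L) := by
      rw [← Real.sin_pi_sub]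
      congr 1
      field_simp
    have e : 2 / Real.pi * (Real.pi * ((L : ℝ) - n) / L) = 2 * ((L : ℝ) - n) / L := by
      field_simp
    rw [hsin, hcast, ← e]
    exact Real.mul_le_sin hx0 hx1

/-- The sines in the dispersion are nonnegative. -/
theorem torus_sin_nonneg (L : ℕ) (n : Fin L) : 0 ≤ Real.sin (Real.pi * ((n : ℕ) : ℝ) / L) := by
  have hL : 0 < L := Fin.pos n
  have hLr : (0 : ℝ) < L := by exact_mod_cast hL
  have hn : ((n : ℕ) : ℝ) ≤ L := by exact_mod_cast (le_of_lt n.isLt)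
  refine Real.sin_nonneg_of_nonneg_of_le_pi (by positivity) ?_
  rw [div_le_iff₀ hLr]
  nlinarith [Real.pi_pos]

/-- Relativistic lower bound on the dispersion. -/
theorem latticeDispersion_lower {m c : ℝ} (hm : 0 ≤ m) (hc : 0 ≤ c) (L : ℕ) (k : Fin 3 → Fin L) :
    (m + c / 3 * ∑ j : Fin 3, 2 * Real.sin (Real.pi * ((k j : ℕ) : ℝ) / L)) / 2 ≤ latticeDispersion m c L k := by
  unfold latticeDispersion
  set s : Fin 3 → ℝ := fun j => 2 * Real.sin (Real.pi * ((k j : ℕ) : ℝ) / L) with hs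
  have hs0 : ∀ j, 0 ≤ s j := fun j => mul_nonneg (by norm_num) (torus_sin_nonneg L (k j))
  have hsum : ∑ j : Fin 3, s j = s 0 + s 1 + s 2 := Fin.sum_univ_three s
  have hsum2 : ∑ j : Fin 3, s j ^ 2 = s 0 ^ 2 + s 1 ^ 2 + s 2 ^ 2 := Fin.sum_univ_three (fun j => s j ^ 2)
  change (m + c / 3 * ∑ j : Fin 3, s j) / 2 ≤ Real.sqrt (m ^ 2 + c ^ 2 * ∑ j : Fin 3, s j ^ 2)
  rw [hsum, hsum2]
  have h0 := hs0 0
  have h1 := hs0 1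
  have h2 := hs0 2
  have hL0 : 0 ≤ (m + c / 3 * (s 0 + s 1 + s 2)) / 2 := by positivity
  refine Real.le_sqrt_of_sq_le ?_
  nlinarith [sq_nonneg (m - c / 3 * (s 0 + s 1 + s 2)), mul_nonneg (sq_nonneg c) (sq_nonneg (s 0 - s 1)),
    mul_nonneg (sq_nonneg c) (sq_nonneg (s 1 - s 2)), mul_nonneg (sq_nonneg c) (sq_nonneg (s 0 - s 2)),
    sq_nonneg c, mul_nonneg (sq_nonneg c) (sq_nonneg (s 0 + s 1 + s 2))]

/-- One-dimensional torus weight sum bound. -/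
theorem torus_weight_sum_le (a : ℝ) (ha : 0 < a) (L : ℕ) :
    ∑ n : Fin L, Real.exp (-(a * ((min (n : ℕ) (L - n) : ℕ) : ℝ))) ≤ 2 * (1 - Real.exp (-a))⁻¹ := by
  set r : ℝ := Real.exp (-a) with hr
  have hr0 : 0 ≤ r := (Real.exp_pos _).le
  have hr1 : r < 1 := by
    rw [hr]
    exact lt_of_lt_of_eq (Real.exp_lt_exp.2 (by linarith : -a < 0)) Real.exp_zero
  have hgeom : HasSum (fun n : ℕ => r ^ n) (1 - r)⁻¹ := hasSum_geometric_of_lt_one hr0 hr1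
  have hpart : ∀ N, ∑ n ∈ Finset.range N, r ^ n ≤ (1 - r)⁻¹ :=
    fun N => sum_le_hasSum (Finset.range N) (fun n _ => pow_nonneg hr0 n) hgeom
  have hexp : ∀ j : ℕ, Real.exp (-(a * (j : ℝ))) = r ^ j := by
    intro j
    rw [hr, ← Real.exp_nat_mul]
    congr 1
    ring
  have hterm : ∀ n : ℕ, n < L →
      Real.exp (-(a * ((min n (L - n) : ℕ) : ℝ))) ≤ r ^ n + r ^ (L - n) := by
    intro n hn
    rcases le_or_gt n (L - n) with h | h
    · rw [min_eq_left h, hexp]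
      linarith [pow_nonneg hr0 (L - n)]
    · rw [min_eq_right h.le, hexp]
      linarith [pow_nonneg hr0 n]
  calc ∑ n : Fin L, Real.exp (-(a * ((min (n : ℕ) (L - n) : ℕ) : ℝ)))
      = ∑ n ∈ Finset.range L, Real.exp (-(a * ((min n (L - n) : ℕ) : ℝ))) :=
        Fin.sum_univ_eq_sum_range (fun n => Real.exp (-(a * ((min n (L - n) : ℕ) : ℝ)))) L
    _ ≤ ∑ n ∈ Finset.range L, (r ^ n + r ^ (L - n)) :=
        Finset.sum_le_sum fun n hn => hterm n (Finset.mem_range.1 hn)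
    _ = ∑ n ∈ Finset.range L, r ^ n + ∑ n ∈ Finset.range L, r ^ (L - n) := Finset.sum_add_distrib
    _ ≤ (1 - r)⁻¹ + (1 - r)⁻¹ := by
        refine add_le_add (hpart L) ?_
        have hrefl : ∑ n ∈ Finset.range L, r ^ (L - n) = ∑ j ∈ Finset.range L, r ^ (j + 1) := by
          rw [← Finset.sum_range_reflect (fun j => r ^ (j + 1)) L]
          refine Finset.sum_congr rfl fun n hn => ?_
          have hn' := Finset.mem_range.1 hn
          congr 1
          omega
        rw [hrefl]
        calc ∑ j ∈ Finset.range L, r ^ (j + 1) ≤ ∑ j ∈ Finset.range L, r ^ j :=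
              Finset.sum_le_sum fun j _ => by
                rw [pow_succ]
                exact mul_le_of_le_one_right (pow_nonneg hr0 j) hr1.le
          _ ≤ (1 - r)⁻¹ := hpart L
    _ = 2 * (1 - r)⁻¹ := by ring

/-- `e^{−2} ≤ 1/2`. -/
theorem exp_neg_two_le_half : Real.exp (-2) ≤ 1 / 2 := by
  have h : (3 : ℝ) ≤ Real.exp 2 := by linarith [Real.add_one_le_exp (2 : ℝ)]
  rw [Real.exp_neg, inv_eq_one_div, div_le_div_iff₀ (Real.exp_pos 2) (by norm_num : (0:ℝ) < 2)]
  linarith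
set_option maxHeartbeats 400000 in
/-- **LEMMA A (real analysis, KERNEL):** the free tower is uniformly small at the cold aspect. -/
theorem gaussTowerExcess_small (d : ℕ) (c : ℝ) (hc : 0 < c) (ε : ℝ) (hε : 0 < ε) :
    ∃ A : ℝ, ∀ (L : ℕ) (m : ℝ), 8 ≤ L → 0 ≤ m → A ≤ m * ((L / 4 : ℕ) : ℝ) →
      gaussTowerExcess d m c L (L / 4) ≤ ε := by
  classical
  set a : ℝ := c / 12 with ha_def
  have ha : 0 < a := by rw [ha_def]; positivity
  set B₁ : ℝ := 2 * (1 - Real.exp (-a))⁻¹ with hB₁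
  have hB₁0 : 0 < B₁ := by
    have : Real.exp (-a) < 1 := lt_of_lt_of_eq (Real.exp_lt_exp.2 (by linarith : -a < 0)) Real.exp_zero
    rw [hB₁]
    have : 0 < 1 - Real.exp (-a) := by linarith
    positivity
  set B : ℝ := B₁ ^ 3 with hB
  have hB0 : 0 < B := by rw [hB]; positivity
  set K : ℝ := 2 * d * B + 1 with hK
  have hK0 : 0 < K := by rw [hK]; positivity
  set ε' : ℝ := min ε 1 with hε'
  have hε'0 : 0 < ε' := by rw [hε']; exact lt_min hε one_pos
  have hε'ε : ε' ≤ ε := min_le_left _ _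
  have hε'1 : ε' ≤ 1 := min_le_right _ _
  set A : ℝ := max 2 (2 * Real.log (4 * K / ε')) with hA_def
  refine ⟨A, fun L m hL hm hA => ?_⟩
  set t : ℕ := L / 4 with ht_def
  have ht8 : L ≤ 8 * t := by omega
  have hLpos : 0 < L := by omega
  have hLr : (0 : ℝ) < L := by exact_mod_cast hLpos
  have htr : (L : ℝ) ≤ 8 * (t : ℝ) := by exact_mod_cast ht8
  have ht0 : (0 : ℝ) ≤ t := Nat.cast_nonneg _
  have hA2 : 2 ≤ A := le_max_left _ _
  have hAlog : 2 * Real.log (4 * K / ε') ≤ A := le_max_right _ _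
  have hmt : 2 ≤ m * t := le_trans hA2 hA
  set y : (Fin 3 → Fin L) → ℝ := fun k => Real.exp (-((t : ℝ) * latticeDispersion m c L k)) with hy_def
  have hy0 : ∀ k, 0 ≤ y k := fun k => (Real.exp_pos _).le
  have hy_half : ∀ k, y k ≤ 1 / 2 := by
    intro k
    have hω : m ≤ latticeDispersion m c L k := mass_le_latticeDispersion hm c L k
    calc y k ≤ Real.exp (-(m * t)) := by
          apply Real.exp_le_exp.2
          nlinarith
      _ ≤ Real.exp (-2) := Real.exp_le_exp.2 (by linarith)
      _ ≤ 1 / 2 := exp_neg_two_le_half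
  set w : Fin L → ℝ := fun n => Real.exp (-(a * ((min (n : ℕ) (L - n) : ℕ) : ℝ))) with hw_def
  have hw0 : ∀ n, 0 ≤ w n := fun n => (Real.exp_pos _).le
  have hwsum : ∑ n : Fin L, w n ≤ B₁ := torus_weight_sum_le a ha L
  have hy_le : ∀ k, y k ≤ Real.exp (-(m * t / 2)) * ∏ j : Fin 3, w (k j) := by
    intro k
    have hdisp := latticeDispersion_lower hm hc.le L k
    have hcoord : ∀ j : Fin 3,
        a * ((min ((k j : ℕ)) (L - (k j : ℕ)) : ℕ) : ℝ) ≤ (t : ℝ) * (c / 3 * (2 * Real.sin (Real.pi * ((k j : ℕ) : ℝ) / L))) / 2 := by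
      intro j
      have hJ := torus_sin_lower L (k j) hLpos (k j).isLt
      have hdist0 : (0 : ℝ) ≤ ((min ((k j : ℕ)) (L - (k j : ℕ)) : ℕ) : ℝ) := Nat.cast_nonneg _
      have h1 : 2 * ((min ((k j : ℕ)) (L - (k j : ℕ)) : ℕ) : ℝ) ≤ (L : ℝ) * Real.sin (Real.pi * ((k j : ℕ) : ℝ) / L) := by
        have := (div_le_iff₀ hLr).1 hJ
        linarith
      rw [ha_def]
      have hsin0 : 0 ≤ Real.sin (Real.pi * ((k j : ℕ) : ℝ) / L) := torus_sin_nonneg L (k j)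
      nlinarith [mul_le_mul_of_nonneg_right htr (mul_nonneg hc.le hsin0)]
    have hsumcoord : ∑ j : Fin 3, a * ((min ((k j : ℕ)) (L - (k j : ℕ)) : ℕ) : ℝ)
        ≤ ∑ j : Fin 3, (t : ℝ) * (c / 3 * (2 * Real.sin (Real.pi * ((k j : ℕ) : ℝ) / L))) / 2 :=
      Finset.sum_le_sum fun j _ => hcoord j
    have hrhs : ∑ j : Fin 3, (t : ℝ) * (c / 3 * (2 * Real.sin (Real.pi * ((k j : ℕ) : ℝ) / L))) / 2
        = (t : ℝ) * (c / 3 * ∑ j : Fin 3, 2 * Real.sin (Real.pi * ((k j : ℕ) : ℝ) / L)) / 2 := by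
      rw [Finset.mul_sum, Finset.mul_sum, Finset.sum_div]
    have hexp_arg : -((t : ℝ) * latticeDispersion m c L k)
        ≤ -(m * t / 2) + ∑ j : Fin 3, (-(a * ((min ((k j : ℕ)) (L - (k j : ℕ)) : ℕ) : ℝ))) := by
      rw [Finset.sum_neg_distrib]
      have h1 := mul_le_mul_of_nonneg_left hdisp ht0
      have h2 : (t : ℝ) * ((m + c / 3 * ∑ j : Fin 3, 2 * Real.sin (Real.pi * ((k j : ℕ) : ℝ) / L)) / 2)
          = m * t / 2 + (t : ℝ) * (c / 3 * ∑ j : Fin 3, 2 * Real.sin (Real.pi * ((k j : ℕ) : ℝ) / L)) / 2 := by ring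
      linarith
    calc y k = Real.exp (-((t : ℝ) * latticeDispersion m c L k)) := rfl
      _ ≤ Real.exp (-(m * t / 2) + ∑ j : Fin 3, (-(a * ((min ((k j : ℕ)) (L - (k j : ℕ)) : ℕ) : ℝ)))) :=
          Real.exp_le_exp.2 hexp_arg
      _ = Real.exp (-(m * t / 2)) * ∏ j : Fin 3, w (k j) := by
          rw [Real.exp_add, Real.exp_sum]
  have hprodsum : ∑ k : Fin 3 → Fin L, ∏ j : Fin 3, w (k j) = (∑ n : Fin L, w n) ^ 3 := by
    have h := Finset.sum_prod_piFinset (Finset.univ : Finset (Fin L)) (fun (_ : Fin 3) (n : Fin L) => w n)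
    rw [Fintype.piFinset_univ] at h
    rw [h, Finset.prod_const, Finset.card_univ, Fintype.card_fin]
  have hYsum : ∑ k : Fin 3 → Fin L, y k ≤ Real.exp (-(m * t / 2)) * B := by
    calc ∑ k : Fin 3 → Fin L, y k ≤ ∑ k : Fin 3 → Fin L, Real.exp (-(m * t / 2)) * ∏ j : Fin 3, w (k j) :=
          Finset.sum_le_sum fun k _ => hy_le k
      _ = Real.exp (-(m * t / 2)) * (∑ n : Fin L, w n) ^ 3 := by rw [← Finset.mul_sum, hprodsum]
      _ ≤ Real.exp (-(m * t / 2)) * B := by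
          rw [hB]
          refine mul_le_mul_of_nonneg_left ?_ (Real.exp_pos _).le
          exact pow_le_pow_left₀ (Finset.sum_nonneg fun n _ => hw0 n) hwsum 3
  -- `(1 − y)⁻¹ ≤ e^{2y}` on `[0, 1/2]` (elementary; the tree's `Literature.NumberTheory.Automorphic.inv_one_sub_le_exp_two_mul`, inlined
  -- here to keep the import closure inside mathematical physics)
  have hinv : ∀ k, (1 - y k)⁻¹ ≤ Real.exp (2 * y k) := fun k => by
    have h1 : 0 < 1 - y k := by linarith [hy_half k]
    calc (1 - y k)⁻¹ ≤ 1 + 2 * y k := by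
          rw [inv_eq_one_div, div_le_iff₀ h1]
          nlinarith [hy0 k, hy_half k]
      _ ≤ Real.exp (2 * y k) := by linarith [Real.add_one_le_exp (2 * y k)]
  have hprod_le : ∏ k : Fin 3 → Fin L, (1 - y k)⁻¹ ≤ Real.exp (2 * ∑ k : Fin 3 → Fin L, y k) := by
    rw [Finset.mul_sum, Real.exp_sum]
    refine Finset.prod_le_prod (fun k _ => ?_) (fun k _ => hinv k)
    have : 0 < 1 - y k := by linarith [hy_half k]
    positivity
  have hprod0 : 0 ≤ ∏ k : Fin 3 → Fin L, (1 - y k)⁻¹ :=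
    Finset.prod_nonneg fun k _ => by
      have : 0 < 1 - y k := by linarith [hy_half k]
      positivity
  set z : ℝ := (d : ℝ) * (2 * ∑ k : Fin 3 → Fin L, y k) with hz
  have hz0 : 0 ≤ z := by
    rw [hz]
    exact mul_nonneg (Nat.cast_nonneg _) (mul_nonneg (by norm_num) (Finset.sum_nonneg fun k _ => hy0 k))
  have hexpA : Real.exp (-(m * t / 2)) ≤ ε' / (4 * K) := by
    have h1 : Real.exp (-(m * t / 2)) ≤ Real.exp (-(A / 2)) := Real.exp_le_exp.2 (by linarith)
    have h2 : Real.exp (-(A / 2)) ≤ Real.exp (-Real.log (4 * K / ε')) := Real.exp_le_exp.2 (by linarith)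
    have h3 : Real.exp (-Real.log (4 * K / ε')) = ε' / (4 * K) := by
      rw [Real.exp_neg, Real.exp_log (by positivity)]
      field_simp
    linarith [h3.le]
  have hz_le : z ≤ ε' / 4 := by
    have h1 : z ≤ 2 * d * B * Real.exp (-(m * t / 2)) := by
      rw [hz]
      have hd0 : (0 : ℝ) ≤ d := Nat.cast_nonneg _
      nlinarith [mul_le_mul_of_nonneg_left hYsum (by positivity : (0:ℝ) ≤ 2 * d)]
    have h2 : 2 * d * B * Real.exp (-(m * t / 2)) ≤ 2 * d * B * (ε' / (4 * K)) :=
      mul_le_mul_of_nonneg_left hexpA (by positivity)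
    have h3 : 2 * (d : ℝ) * B ≤ K := by rw [hK]; linarith
    have h4 : 2 * d * B * (ε' / (4 * K)) ≤ ε' / 4 := by
      rw [mul_div_assoc']
      rw [div_le_div_iff₀ (by positivity) (by norm_num : (0:ℝ) < 4)]
      nlinarith [hε'0.le]
    linarith
  have hz1 : |z| ≤ 1 := by
    rw [abs_of_nonneg hz0]
    linarith
  have hmain : gaussTowerExcess d m c L t ≤ Real.exp z - 1 := by
    unfold gaussTowerExcess
    have h1 : (∏ k : Fin 3 → Fin L, (1 - Real.exp (-((t : ℝ) * latticeDispersion m c L k)))⁻¹) ^ d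
        ≤ (Real.exp (2 * ∑ k : Fin 3 → Fin L, y k)) ^ d := pow_le_pow_left₀ hprod0 hprod_le d
    have h2 : (Real.exp (2 * ∑ k : Fin 3 → Fin L, y k)) ^ d = Real.exp z := by
      rw [hz, ← Real.exp_nat_mul]
    linarith [h2.le, h2.ge]
  have hfinal : Real.exp z - 1 ≤ ε := by
    have h := Real.abs_exp_sub_one_le hz1
    have h' : Real.exp z - 1 ≤ 2 * |z| := le_trans (le_abs_self _) h
    rw [abs_of_nonneg hz0] at h'
    linarith
  exact le_trans hmain hfinal

end Summit.QuantumFields.YangMills.Cruxes.IR.LevelwiseDomination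

end
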